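import Summits.ResolutionOfSingularities.ResolutionOfSingularities.Theorems.FrobeniusLadderFInjectiveMacaulayficationOmegaOneGlobalCureFanCert
import Summits.ResolutionOfSingularities.ResolutionOfSingularities.Theorems.FrobeniusLadderFInjectiveMacaulayficationOmegaCureCentreFactors
import Summits.ResolutionOfSingularities.ResolutionOfSingularities.Theorems.FrobeniusLadderFInjectiveMacaulayficationPrincipalStalkPackage
import Summits.ResolutionOfSingularities.ResolutionOfSingularities.Theorems.FrobeniusLadderFInjectiveMacaulayficationChartPrincipalIdeal
import Summits.ResolutionOfSingularities.ResolutionOfSingularities.Theorems.FrobeniusLadderFInjectiveMacaulayficationClassCentreInvertible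
import Summits.ResolutionOfSingularities.ResolutionOfSingularities.Theorems.FrobeniusLadderFInjectiveMacaulayficationSubconeOrder
import Summits.ResolutionOfSingularities.ResolutionOfSingularities.Theorems.FrobeniusLadderFInjectiveMacaulayficationFullPointChainCap
import Summits.ResolutionOfSingularities.ResolutionOfSingularities.Theorems.FrobeniusLadderFInjectiveMacaulayficationFullSliceChainCap
import Summits.ResolutionOfSingularities.ResolutionOfSingularities.Theorems.FrobeniusLadderFInjectiveMacaulayficationFullLocalOrderCap
import Summits.ResolutionOfSingularities.ResolutionOfSingularities.Theorems.FrobeniusLadderFInjectiveMacaulayficationSliceGenusDiscOrderGeneral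
import Summits.ResolutionOfSingularities.ResolutionOfSingularities.Theorems.FrobeniusLadderFInjectiveMacaulayficationSliceDiscExceptionalFace
import Summits.ResolutionOfSingularities.ResolutionOfSingularities.Theorems.FrobeniusLadderFInjectiveMacaulayficationKLocCellKitEarlyTrunc
import Summits.ResolutionOfSingularities.ResolutionOfSingularities.Theorems.FrobeniusLadderFInjectiveMacaulayficationFullSquareBudget
import Summits.ResolutionOfSingularities.ResolutionOfSingularities.Theorems.FrobeniusLadderFInjectiveMacaulayficationFullLastCentreBudget
import Summits.ResolutionOfSingularities.ResolutionOfSingularities.Theorems.FrobeniusLadderFInjectiveMacaulayficationFullLastCentreBedCExactLaw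
import Summits.ResolutionOfSingularities.ResolutionOfSingularities.Theorems.FrobeniusLadderFInjectiveMacaulayficationFullLocalSquareBudget
import Summits.ResolutionOfSingularities.ResolutionOfSingularities.Theorems.FrobeniusLadderFInjectiveMacaulayficationOmegaOneS2ClassRow
import Summits.ResolutionOfSingularities.ResolutionOfSingularities.Theorems.FrobeniusLadderFInjectiveMacaulayficationSopFrobeniusPower
import HarnessLib

/-!
# F-CENSUS REGISTRAR v9 (third volume; `…FCensusRegistrar` v1–v3 ✓p687725/✓p689758/✓p691771 and `…FCensusRegistrar2` v4–v8 ✓p705652 … ✓p719904 are frozen): one-name aliases for what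
# landed on BED Ω after the F4(c) MILESTONE — the Σ₂ GLOBAL CURE FAN CERTIFICATE as `decide` data (F5), the F5 structure lemma on an invertible class centre, the F6 stalk/chart glue
# (principal orbits, chart generators, effective-Cartier class centre, sub-cone orders) — and the T-side bricks K7♭ (point-chain cap for arbitrary centres), K8 (slice-chain cap) and the
# local-ring form of rows #9/#9♯ (crux `FInjectiveMacaulayfication` stmt-ResolutionOfSingularities-15315, chain w45a; res-L1-w45a-plan-1 ACK l.38644 (1) «registrar v9 = ONE batch AFTER
# stub-3ʼs `OmegaOneGlobalCureFanCert` is ✓ … open `…FCensusRegistrar3.lean` rather than pushing Registrar2 past ~380 l.», R25.14 (a), l.38711 (c); seat res-L1-w45a-stub-1 g17)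

[OURS · L1 W4.5a] Support file (`--supports stmt-ResolutionOfSingularities-15315 --as helper`); `alias`es of LANDED theorems + one conjunction theorem; no new mathematics; nothing of the crux is proved; every
row is OURS and counted 0; an F-census row records «LEGAL ∧ NOT FULL ∧ CURED» for ONE floor, never the crux; the T-side bricks are arithmetic/letter-calculus shadows whose dictionary to
blow-up chains is memo-level [ELEM]. AI-written (AI review weaker than expert review).
* §1 (v9) F5: ★★ the Σ₂ certificate ✓p720728 `OmegaOneGlobalCureFanCert` (res-L1-w45a-stub-3 g14; data ✓p718262/✓p718649/✓p719226/✓p718653/✓p718654 `OmegaOneGlobalCureFanTables1–5`: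
  139 rays, 1223 unimodular cones, parents in Σ(B9), facet pairing, strictly convex support function, exit tags on all 37 913 (cone, orbit) pairs, census
  `[5884, 15251, 158, 32, 15, 630, 0, 0, 0, 15943]`; cross-certificate #5 (res-L1-w45a-stub-1 g17 `g17-xcert5/xcert5.py` 2bed340db8f3b41e: independent `orbitRelevant`/`exitOKW'` engine on
  the in-tree tables — census identical, every recorded tag the MINIMAL admissible code, 0 disagreements) and ✓p719016 `OmegaCureCentreFactors.exists_cure_fac_of_isEffectiveCartier`;
  F6 glue ✓p720419 `PrincipalStalkPackage`, ✓p719703/✓p721262 `ChartPrincipalIdeal`, ✓p719847 `ClassCentreInvertible`, ✓p719116 `SubconeOrder` (all res-L1-w45a-stub-3 g14); T-side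
  ✓p719002 K7♭ (res-L1-w45a-lead-1 g14; POINT-CHAIN CAP OF RECORD, R25.9, after res-L1-w45a-tri-2 g23ʼs `CAP-BREAKTEST-tri2.md` d8625c417938a35e PASS ×4), ✓p721166 K8 `FullSliceChainCap`
  (res-L1-w45a-lead-1 g15; kernel shadow of `T-disc.md` rev 14 §0.17/§0.18), ✓p721620 `FullLocalOrderCap` (res-L1-w45a-stub-1 g17; rows #9/#9♯ at every point of every regular germ).
[cite: CoxLittleSchenck2011, §3.1, §6.1, §7.1, §11.1 (toric blow-ups, support functions, projectivity)] [cite: Fedder1983, Prop. 1.7 and Thm. 1.12] [cite: StacksProject, Tag 080A]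
-/

-- single-problem summit: the doubled namespace component is forced
set_option linter.dupNamespace false

noncomputable section

namespace Summit.ResolutionOfSingularities.ResolutionOfSingularities.Theorems.FInjectiveMacaulayfication.FCensusRegistrar3

open Summit.ResolutionOfSingularities.ResolutionOfSingularities.Theorems.FInjectiveMacaulayfication

/-! ## §1 (v9) BED Ω GLOBAL PATCH: THE Σ₂ CERTIFICATE (F5), F5 STRUCTURE ON AN INVERTIBLE CLASS CENTRE, F6 GLUE; T-SIDE K7♭ / K8 / #9–#9♯ LOCAL -/

/-- ★ F5 CERT: every one of the 1223 cones of the global cure fan Σ₂ is unimodular (explicit integer inverses, `decide +kernel`). [alias of ✓p720728, res-L1-w45a-stub-3] -/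
alias f5_cert_S2_det := OmegaOneGlobalCureFanCert.cert_S2_det
/-- ★ F5 CERT: every cone of Σ₂ lies in its parent cone of Σ(B9) (ℕ-coefficient certificate) — Σ₂ REFINES Σ(B9). [alias of ✓p720728, res-L1-w45a-stub-3] -/
alias f5_cert_S2_subcones := OmegaOneGlobalCureFanCert.cert_S2_subcones
/-- ★ F5 CERT: facet pairing (every facet has a registered neighbour or lies in a coordinate hyperplane) — completeness over the orthant. [alias of ✓p720728, res-L1-w45a-stub-3] -/
alias f5_cert_S2_facets := OmegaOneGlobalCureFanCert.cert_S2_facets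
/-- ★ F5 CERT: the support function `H_S2` is strictly convex with non-negative vertices — Σ₂ is the normal fan of a monomial ideal `K″`, `X_{Σ₂} = Bl_{K″} 𝔸⁵` projective, `V(K″) = {0}`.
[alias of ✓p720728, res-L1-w45a-stub-3; cite: CoxLittleSchenck2011, Prop. 6.1.10, Thm. 7.1.10] -/
alias f5_cert_S2_support := OmegaOneGlobalCureFanCert.cert_S2_support
/-- ★★ F5 CERT: EVERY (cone, torus orbit meeting the strict transform) of Σ₂ passes the strengthened weighted exit check ✓ `exitOKW'` with its recorded tag (`P = x u²`, `Q = y³`,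
`C = ⟨ρ, m_L(parent)⟩`); irrelevant orbits are tagged `9`. Cross-certificate #5 (two engines, 0 disagreements; every tag the minimal admissible code). [alias of ✓p720728, res-L1-w45a-stub-3] -/
alias f5_cert_S2_exits := OmegaOneGlobalCureFanCert.cert_S2_exits
/-- F5 CERT: the exit-tag census of Σ₂, codes `0 … 9`: `[5884, 15251, 158, 32, 15, 630, 0, 0, 0, 15943]` (principal 5884; pencil codes 1–5: 16 086; deep codes 6–8 never; irrelevant 15 943).
[alias of ✓p720728, res-L1-w45a-stub-3] -/
alias f5_census_S2 := OmegaOneGlobalCureFanCert.census_S2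
/-- ★ F5 STRUCTURE: `Bl_{(L³ + (g)L²)K″} X → Bl_{K″} X` is a blowing up along `(L + (g))·𝒪` as soon as `L·𝒪_{Bl_{K″} X}` is invertible (080A read backwards; the invertible factor `(L𝒪)²`
discarded). [alias of ✓p719016, res-L1-w45a-stub-3; cite: StacksProject, Tag 080A] -/
alias f5_exists_cure_fac_of_isEffectiveCartier := OmegaCureCentreFactors.exists_cure_fac_of_isEffectiveCartier
/-- ★★ F6 GLUE (principal branch, stalk form): `𝒥(W) = (γu, γv)`, `γ` regular, `u` a unit at `x = τ s` ⇒ `FullCl p 𝒪_{X̃,x} → FullCl p 𝒪_{S′,s}` — the tag-0 orbits at stalk level.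
[alias of ✓p720419, res-L1-w45a-stub-3; cite: StacksProject, Tag 02OS] -/
alias f6_fullCl_stalk_of_pair_unit := PrincipalStalkPackage.fullCl_stalk_of_pair_unit
/-- F6 GLUE (principal branch): the CM clause alone, same shape. [alias of ✓p720419, res-L1-w45a-stub-3] -/
alias f6_cmCl_stalk_of_pair_unit := PrincipalStalkPackage.cmCl_stalk_of_pair_unit
/-- ★ F6 GLUE: a monomial ideal whose order is attained at a member is principal on the toric chart: `(x^e : e ∈ B)~·𝒪(D₊(x^m t)) = (Φ⁻¹ ȳ^{V b})`. [alias of ✓p719703, res-L1-w45a-stub-3;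
cite: CoxLittleSchenck2011, §3.1] -/
alias f6_ideal_comap_span_monomials_chart := ChartPrincipalIdeal.ideal_comap_span_monomials_chart
/-- ★ F6 GLUE: the effective-Cartier witness on a chart (`θ` prime and free of variables): `(x^e : e ∈ B)~·𝒪(D₊(x^m t)) = (γ)`, `γ` a non-zero-divisor. [alias of ✓p719703, res-L1-w45a-stub-3] -/
alias f6_exists_generator_of_chart := ChartPrincipalIdeal.exists_generator_of_chart
/-- ★ F6 GLUE: the same generator WITHOUT primality of `θ` — chart ring a domain, `θ(0) ≠ 0`, `θ` not a unit (the form usable on all 1223 charts of `X̃₂`). [alias of ✓p721262, res-L1-w45a-stub-3] -/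
alias f6_exists_generator_of_chart' := ChartPrincipalIdeal.exists_generator_of_chart'
/-- ★★ F6 GLUE: `(x^e : e ∈ B)·𝒪_{Bl_A X}` is an EFFECTIVE CARTIER DIVISOR when the vertex charts cover and the order of `B` is attained on each (the hypothesis `hL` of
`f5_exists_cure_fac_of_isEffectiveCartier`). [alias of ✓p719847, res-L1-w45a-stub-3; cite: CoxLittleSchenck2011, §3.1, §11.1] -/
alias f6_isEffectiveCartier_comap_span_monomials := ClassCentreInvertible.isEffectiveCartier_comap_span_monomials
/-- ★ F6 GLUE: the `hge` binder (order of `L` attained at the vertex) descends from a cone of Σ(B9) to every sub-cone of Σ₂ (`V_σ = N·V_c`, `N` over `ℕ`). [alias of ✓p719116, res-L1-w45a-stub-3] -/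
alias f6_hge_of_subcone := SubconeOrder.hge_of_subcone
/-- F6 GLUE: on a sub-cone the order of `L` is still `V_σ m_L(c)`. [alias of ✓p719116, res-L1-w45a-stub-3] -/
alias f6_order_eq_of_subcone := SubconeOrder.order_eq_of_subcone
/-- ★★ K7♭ (T-register ROW #11♯) — POINT-CHAIN CAP THEOREM OF RECORD (R25.9): [ELEM + BUDGET] dictionary two engines (res-L1-w45a-lead-1 `T-disc.md` + res-L1-w45a-tri-2 g23
`CAP-BREAKTEST-tri2.md` d8625c417938a35e PASS ×4) + kernel arithmetic shadow; counted 0; the algebra → slack dictionary at a FULL triple point is memo-level. SLACK DOMINATION for ARBITRARY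
point centres — each step may leave any subset of the divisors through the point; `Σ_{i∈I_j} σ_i⁺ ≤ σ_j⁺`. [alias of ✓p719002, res-L1-w45a-lead-1] -/
alias tside_slack_domination_subset := FullPointChainCap.slack_domination_subset
/-- ★★ K7♭: THE POINT-CHAIN CAP for arbitrary closed-point centres — `ord N ≤ 8` at every rank-one drop point of every chain of point blow-ups over a FULL triple point with `x³` in its
cone ((Q-flag) covered for point chains); cap OF RECORD (R25.9). [alias of ✓p719002, res-L1-w45a-lead-1] -/
alias tside_pointChain_ordN_le_eight_subset := FullPointChainCap.pointChain_ordN_le_eight_subset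
/-- ★ K8 — kernel shadow of `T-disc.md` rev 14 §0.17/§0.18; the SLICE-CHAIN dictionary (generic points of a section tower = a point chain of the 3-fold slice, budget `6 + 2Σ d_E`) is
[ELEM, provisional — res-L1-w45a-tri-2 R25.12 (c)]; counted 0. Slack domination with an INITIAL boundary set (excess `θ = Σ_{I₀} τ⁺`; K7♭ = the case `I₀ = ∅`).
[alias of ✓p721166, res-L1-w45a-lead-1] -/
alias tside_slack_domination_init := FullSliceChainCap.slack_domination_init
/-- ★ K8: the cap with an ARBITRARY budget constant `c` and initial excess `θ` (`c = 8`: the 4-fold chain; `c = 6`: the 3-fold SLICE chain of a section tower). [alias of ✓p721166, res-L1-w45a-lead-1] -/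
alias tside_chain_cap_init := FullSliceChainCap.chain_cap_init
/-- ★ K8: THE SLICE CAP — the generic residual order along every section of a section tower is `≤ 7 + τ⁻`, at every depth (dictionary «generic points of the sections = a point chain of the
3-fold slice with budget `6 + 2Σ d_E`» is memo-level [ELEM], R25.12 (c)). [alias of ✓p721166, res-L1-w45a-lead-1] -/
alias tside_sliceCap_le_seven := FullSliceChainCap.sliceCap_le_seven
/-- K8: the LAST-SECTION equivalence (LS) — the mixed cap `ρ′ ≤ 8` at a drop point over the special point of the top section ⟺ `2D′ + ν − 8 ≤ δ`. [alias of ✓p721166, res-L1-w45a-lead-1] -/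
alias tside_lastSection_cap_iff := FullSliceChainCap.lastSection_cap_iff
/-- ★★ #9/#9♯ LOCAL FORM: in a regular local ring of dimension `d`, `𝔪^{d(q−1)+1} ⊆ 𝔪^{[q]}` (any `q`; pigeonhole on `d` generators). [alias of ✓p721620, res-L1-w45a-stub-1] -/
alias tside_maximalIdeal_pow_le_frobeniusPower := FullLocalOrderCap.maximalIdeal_pow_le_frobeniusPower
/-- ★★★ #9 LOCAL FORM (ORDER CAP, Fedder reading): a nonzero `f ∈ 𝔪^{dim R + 1}` of a regular local ring of characteristic `p` defines a hypersurface ring `R/(f)` which is NOT FULL — at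
every point (closed or not, any residue field), every prime `p`. [alias of ✓p721620, res-L1-w45a-stub-1; cite: Fedder1983, Prop. 1.7 and Thm. 1.12] -/
alias tside_not_fullCl_of_mem_pow_succ_dim := FullLocalOrderCap.not_fullCl_of_mem_pow_succ_dim
/-- ★★★ #9♯ LOCAL FORM (p-EDGE, Fedder reading): `dim R ≤ p`, `f = ℓ^p + h ≠ 0` with `ℓ ∈ 𝔪`, `h ∈ 𝔪^{p+1}` ⇒ `R/(f)` is NOT FULL. [alias of ✓p721620, res-L1-w45a-stub-1; cite: Fedder1983,
Prop. 1.7 and Thm. 1.12] -/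
alias tside_not_fullCl_of_eq_pow_add := FullLocalOrderCap.not_fullCl_of_eq_pow_add

/-! ## §1b Conjunction theorem: the Σ₂ certificate in one sentence -/

open FanCheckKit OmegaOneGlobalCureFanCert in
/-- ★★ **THE Σ₂ GLOBAL CURE FAN CERTIFICATE (F5) IN ONE SENTENCE**: unimodular ∧ refines Σ(B9) ∧ facet-paired ∧ strictly convex support ∧ every relevant (cone, orbit) exit-tagged ∧ the
census — the conjunction of ✓p720728ʼs six `decide +kernel` certificates (COMBINATORICS ONLY; the toric/blow-up semantics is F6). [OURS · conjunction of ✓p720728, res-L1-w45a-stub-3] -/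
theorem f5_sigma2_certificate :
    checkDetUnit 5 RAYS_S2 CL_S2 VINV_S2 = true ∧
      checkSubcones 5 RAYS_S2 CONES_S2 CONES_B9IDX PARENT_S2 COEF_S2 = true ∧
      checkFacetsNbr 5 RAYS_S2 CONES_S2 NBR_S2 = true ∧
      checkSupport 5 RAYS_S2 CONES_S2 VINV_S2 H_S2 = true ∧
      checkExitsRel 5 [1, 0, 2, 0, 0] [0, 3, 0, 0, 0] FEXPS_B9 RAYS_S2 CONES_S2 CWS_S2 PARENT_S2 ORB5 TAGS_S2 = true ∧
      ((List.range 10).map fun t => TAGS_S2.flatten.count t) = [5884, 15251, 158, 32, 15, 630, 0, 0, 0, 15943] :=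
  ⟨cert_S2_det, cert_S2_subcones, cert_S2_facets, cert_S2_support, cert_S2_exits, census_S2⟩

/-! ## §2 (v10) T-SIDE K-T1 (✓p722715 / ✓p722787 / ✓p723370) AND K-T2 CORE (✓p723512): the algebraic cores of the two necessary tests behind the depth-3 verdict
«(O2)/(O3)@11 = ∅ for every f» (res-L1-w45a-plan-1 R24.43 / R25.13 / R25.18 / R25.22) — which now reads «[ELEM slice dictionary, two engines] + KERNEL K-T1 + T2 [ELEM two engines;
algebraic core kernel K-T2]»; the early-truncating Fedder cell kit (✓p723279, F-side infrastructure, no bed certified) — all res-L1-w45a-stub-1 g17 — and res-L1-w45a-lead-1 g15ʼs K9 SQUARE BUDGET (✓p723669;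
`Lines/T-register.md` rev 10 7a938859fd4269f0 row #11♯ second footnote). Counted 0. -/

/-- K-T1: the `r`-expansion of the slice discriminant, certified against Mathlibʼs `Cubic.discr` (`Disc_x(x³ + βx² + q₂x + q₃) = Σ₂¹² Dᵢ rⁱ`). [alias of ✓p722715, res-L1-w45a-stub-1] -/
alias tside_discr_expand := SliceGenusDiscOrder.discr_expand
/-- ★★ K-T1 (`t1_graph`): on the triangular graph `D₂ = ⋯ = D₆ = 0`, `D₇ = D₈ = D₉ = 0` forces the `Disc ≡ 0` plane `G₃ = G₄ = 0` (field, `2·3·β` invertible; `D₁₀` unused).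
[alias of ✓p722715, res-L1-w45a-stub-1] -/
alias tside_t1_graph := SliceGenusDiscOrder.G_eq_zero
/-- ★★★ K-T1 (`disc_eq_zero_of_order_ge_ten`): for the normalised slice cubic `x³ + βx² + q₂x + q₃ ∈ K[r][x]` (`deg q₂ ≤ 4`, `q₂(0) = 0`, `deg q₃ ≤ 6`, `ord q₃ ≥ 2`, `β ≠ 0`,
`char ∉ {2,3}`): the coefficients of `r⁰ … r⁹` of `Disc_x` vanish ⇒ `Disc_x = 0` — T1ʼs «ord_r Disc ≤ 9 or Disc ≡ 0» with no curve theory. [alias of ✓p722715, res-L1-w45a-stub-1] -/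
alias tside_disc_eq_zero_of_order_ge_ten := SliceGenusDiscOrder.discr_eq_zero_of_coeff_eq_zero
/-- K-T1 general form: the division-free Tschirnhaus step `Disc(27·Q((X − s)/3)) = 729·Disc Q` (any commutative ring). [alias of ✓p723370, res-L1-w45a-stub-1] -/
alias tside_discr_tschirnhaus_scaled := SliceGenusDiscOrder.discr_tschirnhaus_scaled
/-- ★★★ K-T1 GENERAL `q₁`: the same conclusion for the UN-normalised weighted-degree-6 slice cubic `x³ + q₁x² + q₂x + q₃`, `deg q₁ ≤ 2`, `q₁(0) = β ≠ 0` (the rank-one coefficient) —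
only the slice IDENTIFICATION of T1 stays memo-level. [alias of ✓p723370, res-L1-w45a-stub-1] -/
alias tside_disc_eq_zero_of_order_ge_ten_general := SliceGenusDiscOrder.discr_eq_zero_of_coeff_eq_zero_general
/-- ★ K-T2 CORE: the exceptional-face expansion `Disc_x((x−φ)²(x−φ+B) + e(G₀ + G₁(x−φ) + G₂(x−φ)²)) = e·(−4B³G₀ + e(…) + e²(…) + e³(…))` (any commutative ring; with `G₂ = 0` it is
res-L1-w45a-stub-2ʼs printed `D₁`). The degree bookkeeping of T2 and the converse «`e ∣ Disc` ⇒ double root on the face» stay memo-level. [alias of ✓p723512, res-L1-w45a-stub-1] -/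
alias tside_discr_doubleRoot_deformation := SliceDiscExceptionalFace.discr_doubleRoot_deformation
/-- K-T2 CORE, ideal form: `Disc − e·(−4B³G₀) ∈ (e²)` — the `e¹`-coefficient along a face carrying a double root is `4(ψ−φ)³G(φ)`. [alias of ✓p723512, res-L1-w45a-stub-1] -/
alias tside_discr_sub_linear_mem_span_face_sq := SliceDiscExceptionalFace.discr_sub_linear_mem_span_face_sq
/-- F-SIDE KIT: all early-truncated Fedder cells of one chart from ONE `decide +kernel` (`checkKsModE`: truncation inside every product), conclusion = ✓ `klocCellsMod_of_check'` verbatim.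
No bed certified with it yet (res-L1-w45a-plan-1 l.38826: reserved for a canonically-legal wild bed = ROW #10‴). [alias of ✓p723279, res-L1-w45a-stub-1] -/
alias kit_klocCellsModE_of_check' := KLocCellKit.klocCellsModE_of_check'

/-- K-T1 SHARPNESS: for the division-free `A₈` family `x³ + βx² + 2βc·r³x + βc²·r⁶`, `Disc = 4β³c³·r⁹ − 27β²c⁴·r¹²` (any commutative ring) — `ord_r Disc = 9` is attained, so the finite
orders of the slice discriminant are exactly `≤ 9`. [alias of ✓p723796, res-L1-w45a-stub-1] -/
alias tside_discr_A8_family := SliceGenusDiscOrder.discr_A8_family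
/-- ★★ K9 SQUARE BUDGET (res-L1-w45a-lead-1 g15; `T-register.md` rev 10 7a938859fd4269f0, row #11♯): in characteristic `p ≥ 3`, for ANY weight vector `w`, if `f = h²·l + g` with
`coeff₀ h = 0`, every monomial of `h²l` of weight `≥ wS`, every monomial of `g` of weight `≥ wg ≥ wS`, and `f^{p−1} ∉ (Xᵢ^p)` (Fedder survivor), then `wS + wg ≤ 2Σ wᵢ` — the kernel form
of the drop-point budget §0.2 and of the section square budget §0.22 of `T-disc.md`. [alias of ✓p723669, res-L1-w45a-lead-1] -/
alias tside_square_budget := FullSquareBudget.square_budget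
/-- K9: exact square-cubics `h²·l` (`h(0) = 0`, char `p ≥ 3`) are never Fedder survivors — a polynomial-level generalisation of TC-β ✓p717528. [alias of ✓p723669, res-L1-w45a-lead-1] -/
alias tside_sq_mul_pow_mem_frobPow := FullSquareBudget.sq_mul_pow_mem_frobPow


/-! ## §3 (v11) T-SIDE K10 KERNEL AND THE TYPED DOORʼS FATE; RULE (b′) PROVISIONAL + RULE TAGS (res-L1-w45a-plan-1 R26.1 / R26.7); F-SIDE Σ₂ CLASS ROW AND THE F6 PARAMETER ALGEBRA
(`Lines/T-register.md` rev 11 698f1a49661d2c4f, ROW #13 «the one-step law · the typed door and its fate · the exact permissive record · (O-A0) mechanism»). K10 = res-L1-w45a-lead-1 g16 ✓p727906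
`FullLastCentreDefs` (typed one-centre layer: `Stage`, `Permissible`, `IsChart`, `IsResidual`, `OrdLE`, `AxisOrdLE`, `Budgeted`, `CoordCanonical`, `TopLocusIs`), ✓p729098 `FullLastCentreAxisOrder`
(`disc_chart`, cone-initial inequality `rho_le_axisOrd`, ★★★ exact law `residual_transport` / `ordLE_iff`, point law `rho_le_rho_of_point`), ✓p729821 `FullLastCentreResidual`, ✓p730259
`FullLastCentreBudget` (★★ `budgeted_chart`: the toric budget scheme is transported exactly by a chart); THE DOORʼS FATE = res-L1-w45a-stub-1 g17 ✓p729709 `FullLastCentreKitTools` + ✓p730359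
`FullLastCentreBedCInstance` (★★★ `not_lastCentreConeBound_coordCanonical`: the typed one-centre cut (LC) `LastCentreConeBound CoordCanonical` = `DoorCoordProxy` of `Lines/T_canon_door.lean` §3 is
FALSE at bed cʼs canonical surface centre Π₂ over every field of characteristic 11, data = res-L1-w45a-tri-2 g23 dump b752767d37e69ff0, three engines on the loci and two on the instance before the
kernel) + `FullLastCentreBedCExactLaw` (★★★ `rho'_eq_six` / `door_vs_law`: at the same instance the cone-initial order is EXACTLY 11 while the TRUE residual order is ρ′ = 6 ≤ 8 — the door dies,
MC-8ᶜʼs inequality holds with margin 2). RULE TAGS OF RECORD (R26.7 (C)): (LC) refuted-as-door [b] (dead as a one-centre statement over permissible top-locus centres under any rule); the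
conjecture of record is CHAIN-LEVEL (`MC8cChain`, `T_canon_door` v5/v6 §3b, R26.1) and its «canonical sequence» must be a TERMINATING rule: rule (b) (Sing₃-components → singular strata → first
regular `T_i`, R25.26) DOES NOT TERMINATE (bed 13/#190 same-axis tower, tri-2 + lead-1 second engine, R26.7 (A)); **RULE (b′)+(M) «secondary-max» ADOPTED PROVISIONALLY** (R26.7 (B) as
amended by R26.9 (B): (b) driven by the maximal-contact secondary order ω₂ = ord N♮, available because every multiplicity met is ≤ 3 < p; monomial-case clause (M)); **RULE BAKE-OFF R1/R2
PENDING** (R26.9 (C)); «T-depth4 @11» QUALIFIED: class (B) M-sector `E₃⁶E₄²` OPEN (R26.11); tags [b] = rule (b), [cc]/[rec] = coordinate/recursion proxies, [perm] = permissive;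
the MC-8ᶜ inequality, the exact one-step law K10, BIRTH/INVARIANCE, the class rows and the whole F-side are RULE-FREE; the kernel negatives here are cc-level and unaffected (R26.7 (E)).
Also registered: the κ = 3 sharpness of K-T1 (✓p723961 `discr_classD_slice`: order 11 attained in class (D)ʼs degree shape), the coordinate-free K9 at every point (✓p724222
`FullLocalSquareBudget`), and on the F-side res-L1-w45a-stub-3 g15ʼs Σ₂ K″-centre Newton binders ✓p728186 `OmegaOneS2KNewtonKFan`, ★★ class row ✓p728611 `OmegaOneS2ClassRow.affineBlowup_K2_fullCl_b9`
(`Bl_{K″} X_{B9}` is `FullCl p` at every point) and the F6 parameter algebra ✓p730464 `SopFrobeniusPower` (`∏ sᵢ^{p−1} ∉ 𝔪^[p]` for a regular s.o.p.). Counted 0; nothing of the crux proved. -/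

/-- K10 ★ DISCRIMINANT TRANSPORT along a chart of the blow-up of a permissible coordinate centre: `σ_L(Disc_x P) = y_L⁶ · Disc_x P′`. [alias of ✓p729098, res-L1-w45a-lead-1] -/
alias tside_disc_chart := LastCentreAxisOrder.disc_chart
/-- K10 ★★ THE CONE-INITIAL INEQUALITY (no genericity, any history): `AxisOrdLE Nor L N m → OrdLE N′ m` — the residual order at the chart origin is at most the order there of the cone-initial
part of `N`. TRUE as an inequality; FALSE as a door with `m = 8` (`tside_not_lastCentreConeBound_coordCanonical`). [alias of ✓p729098, res-L1-w45a-lead-1] -/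
alias tside_rho_le_axisOrd := LastCentreAxisOrder.rho_le_axisOrd
/-- K10 ★★★ THE RESIDUAL TRANSPORT (exact): `e′ ∈ supp N′ ⟺ e′ + ν·ε_L = τ e` for some `e ∈ supp N` — `N′ = σ_L(N)/y_L^ν` monomial by monomial. [alias of ✓p729098, res-L1-w45a-lead-1] -/
alias tside_residual_transport := LastCentreAxisOrder.residual_transport
/-- K10 ★★★ THE EXACT ONE-STEP LAW: `ord₀ N′ ≤ m ⟺ ∃ e ∈ supp N, |e| + ndeg_Z e ≤ m + e_L + ν`, i.e. `ρ′ = min_e [(|e| − e_L) + (ndeg_Z e − ν)]` — ALWAYS an equality (R25.41 (iii)).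
[alias of ✓p729098, res-L1-w45a-lead-1] -/
alias tside_ordLE_iff := LastCentreAxisOrder.ordLE_iff
/-- K10 ★★ THE POINT LAW `ρ′ ≤ ρ` (`Nor = univ`): the residual order never increases under a point blow-up, at every chart origin (no budget, no canonicity). [alias of ✓p729098, res-L1-w45a-lead-1] -/
alias tside_rho_le_rho_of_point := LastCentreAxisOrder.rho_le_rho_of_point
/-- K10b: every non-zero `D` has a residual decomposition `D = y^α·N` w.r.t. any set of exceptional letters. [alias of ✓p729821, res-L1-w45a-lead-1] -/
alias tside_exists_isResidual := LastCentreResidual.exists_isResidual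
/-- K10b: the initial (multiplicity-3, `Nor = univ`-permissible) stage is never a drop point. [alias of ✓p729821, res-L1-w45a-lead-1] -/
alias tside_not_isDropPoint_of_permissible_univ := LastCentreResidual.not_isDropPoint_of_permissible_univ
/-- K10c ★ THE BUDGET IDENTITY (defect rule): `B(S; w_x′ + w′_L, W) = B(S′; w_x′, w′) + 3·w′_L`. [alias of ✓p730259, res-L1-w45a-lead-1] -/
alias tside_bound_transport := LastCentreBudget.bound_transport
/-- K10c ★★ THE TORIC BUDGET SCHEME IS TRANSPORTED EXACTLY BY A BLOW-UP CHART: `L ∈ Nor → IsChart S Nor L S′ → Budgeted S → Budgeted S′`. [alias of ✓p730259, res-L1-w45a-lead-1] -/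
alias tside_budgeted_chart := LastCentreBudget.budgeted_chart
/-- DOOR TOOLS: the chart identity `σ_L(b) = y_L^j·b′` on term lists from ONE divisibility check of a keyed normal form (`chartNF`). [alias of ✓p729709, res-L1-w45a-stub-1] -/
alias tside_chart_identity_of_nf := LastCentreKit.chart_identity_of_nf
/-- DOOR TOOLS: the keyed term-list expression of the cubic discriminant evaluates to `disc`. [alias of ✓p729709, res-L1-w45a-stub-1] -/
alias tside_evalK_discExpr := LastCentreKit.evalK_discExpr
/-- ★★★ THE DOOR INSTANCE: over every field of characteristic 11, bed cʼs stage-2 data at the canonical surface centre Π₂ satisfy ALL NINE hypotheses of the typed door while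
`¬ AxisOrdLE Nor L N 8`. [alias of ✓p730359, res-L1-w45a-stub-1; data res-L1-w45a-tri-2 dump b752767d37e69ff0] -/
alias tside_door_bedC_counterexample := LastCentreBedC.counterexample
/-- ★★★ THE TYPED DOOR `LastCentreConeBound CoordCanonical` (`DoorCoordProxy`, `Lines/T_canon_door.lean` §3, restated verbatim) IS FALSE (refuted at `ZMod 11`). Tag [b]/cc-level: dead as a
one-centre statement under any rule; the chain-level conjecture `MC8cChain` is untouched. [alias of ✓p730359, res-L1-w45a-stub-1] -/
alias tside_not_lastCentreConeBound_coordCanonical := LastCentreBedC.not_lastCentreConeBound_coordCanonical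
/-- ★★★ THE EXACT LAW AT THE SAME INSTANCE: residual decompositions of `Disc_x(S′)` exist and every one has `ord₀ N′ ≤ 6 ∧ ¬ ord₀ N′ ≤ 5` — `ρ′ = 6 ≤ 8`, margin 2. [alias, res-L1-w45a-stub-1 on ✓p729098] -/
alias tside_door_bedC_rho'_eq_six := LastCentreBedC.rho'_eq_six
/-- ★★★ DOOR VERSUS LAW IN ONE SENTENCE: cone-initial order EXACTLY 11 (`AxisOrdLE … 11 ∧ ¬ … 10 ∧ ¬ … 8`) while `ρ′ = 6`. [alias, res-L1-w45a-stub-1 on ✓p729098] -/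
alias tside_door_vs_law := LastCentreBedC.door_vs_law
/-- K-T1 SHARPNESS IS A `κ = 2` PHENOMENON: in class (D)ʼs degree shape (`deg q_j ≤ 3j`) `ord_y Disc = 11` is attained (division-free form of res-L1-w45a-stub-2ʼs slice cubic; any commutative ring).
[alias of ✓p723961, res-L1-w45a-stub-1] -/
alias tside_discr_classD_slice := SliceGenusDiscOrder.discr_classD_slice
/-- … with `coeff₁₁ = 256` and `coeff_{≤ 10} = 0`. [alias of ✓p723961, res-L1-w45a-stub-1] -/
alias tside_discr_classD_slice_coeff := SliceGenusDiscOrder.discr_classD_slice_coeff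
/-- ★★ K9 AT EVERY POINT OF EVERY REGULAR GERM (coordinate-free square budget): `R` regular local of char `p ≥ 3`, dim `d`, `R/(f)` FULL, `f = h²l + g`, `h ∈ 𝔪^a` (`a ≥ 1`), `l ∈ 𝔪^b`, `g ∈ 𝔪^c`,
`2a + b ≤ c` ⇒ `2a + b + c ≤ 2d`. [alias of ✓p724222, res-L1-w45a-stub-1; cite: Fedder1983, Prop. 1.7 and Thm. 1.12] -/
alias tside_sq_budget_of_fullCl := FullLocalSquareBudget.sq_budget_of_fullCl
/-- An exact square-cubic `h²·l` (`h ∈ 𝔪`, `h²l ≠ 0`) never defines a FULL hypersurface ring. [alias of ✓p724222, res-L1-w45a-stub-1] -/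
alias tside_not_fullCl_of_sq_mul := FullLocalSquareBudget.not_fullCl_of_sq_mul
/-- F5/F6 ★★ THE NEWTON BINDER `hmin` on the 1223 K″-charts of Σ₂ (common minimiser of `supp f_B9` per chart). [alias of ✓p728186, res-L1-w45a-stub-3] -/
alias f6_knewton_hmin := OmegaOneS2KNewtonKFan.hmin
/-- F5/F6 the cover identities `hcov` of the 6032-generator centre `K″`, chunk by chunk. [alias of ✓p728186, res-L1-w45a-stub-3] -/
alias f6_knewton_hcov := OmegaOneS2KNewtonKFan.hcov
/-- ★★ CLASS ROW: `X̃₂ = Bl_{K″} X_{B9}` IS `FullCl p` AT EVERY POINT (`k = k̄`, `2·3 ≠ 0`) — the class route on the K″-centre tables of the global cure fan Σ₂. [alias of ✓p728611, res-L1-w45a-stub-3] -/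
alias f6_affineBlowup_K2_fullCl_b9 := OmegaOneS2ClassRow.affineBlowup_K2_fullCl_b9
/-- F6 PARAMETER ALGEBRA ★ `∏ sᵢ^{p−1} ∉ 𝔪^[p]` for a regular system of parameters of a regular local ring of characteristic `p` (the Fedder input of the pencil charts over the regular base).
[alias of ✓p730464, res-L1-w45a-stub-3; cite: HunekeSwanson2006, proof of Thm. 13.1.2 (6); Matsumura1987, Thm. 14.2] -/
alias f6_prod_pow_sub_one_not_mem_frobeniusPower := SopFrobeniusPower.prod_pow_sub_one_not_mem_frobeniusPower
/-- F6 PARAMETER ALGEBRA: `u·s^e + G ∉ 𝔪^[p]` when `u` is a unit, `e ≤ p − 1` componentwise and `G·s^{p−1−e} ∈ 𝔪^[p]`. [alias of ✓p730464, res-L1-w45a-stub-3] -/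
alias f6_unit_mul_monomial_add_not_mem_frobeniusPower := SopFrobeniusPower.unit_mul_monomial_add_not_mem_frobeniusPower
/-- F6 PARAMETER ALGEBRA: `x ∈ 𝔪 ∖ 𝔪²` ⇒ `x^{p−1} ∉ 𝔪^[p]` (regular local ring of characteristic `p`). [alias of ✓p730464, res-L1-w45a-stub-3] -/
alias f6_pow_sub_one_not_mem_frobeniusPower_of_not_mem_sq := SopFrobeniusPower.pow_sub_one_not_mem_frobeniusPower_of_not_mem_sq

/-! ## §3b Conjunction theorem: the typed one-centre layer in one sentence — what survives a blow-up chart (budget, point law) and what died (the cone bound at a surface centre) -/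

open LastCentreDefs in
/-- ★★★ **THE TYPED ONE-CENTRE LAYER IN ONE SENTENCE**: (i) the toric budget scheme is transported exactly by every chart of the blow-up of a coordinate centre (K10c ✓p730259); (ii) at a POINT
centre the residual order never increases, `ρ′ ≤ ρ` (K10 ✓p729098); (iii) but for positive-dimensional canonical centres the cone-initial door `LastCentreConeBound CoordCanonical` with bound 8
is FALSE (✓p730359) — the conjecture of record is therefore chain-level (`MC8cChain`, R26.1) under the terminating rule (b′) (R26.7, provisional). [OURS · conjunction of ✓p730259 / ✓p729098 /
✓p730359; res-L1-w45a-lead-1 + res-L1-w45a-stub-1] -/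
theorem tside_typed_layer_one_sentence :
    (∀ (k : Type) [Field k] (S S' : Stage k) (Nor : Finset Letter) (L : Letter), L ∈ Nor → IsChart S Nor L S' → Budgeted S → Budgeted S') ∧
      (∀ (k : Type) [Field k] (S S' : Stage k) (α α' : Expo) (N N' : YPoly k) (L : Letter) (m : ℕ),
          IsChart S Finset.univ L S' → IsResidual S.Exc S.D α N → IsResidual S'.Exc S'.D α' N' → OrdLE N m → OrdLE N' m) ∧
      ¬ (∀ (k : Type) [Field k] (S S' : Stage k) (Nor : Finset Letter) (L : Letter) (α : Expo) (N : YPoly k),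
          Nor.Nonempty → L ∈ Nor → Permissible S Nor → CoordCanonical S Nor → Budgeted S →
            IsChart S Nor L S' → IsDropPoint S' → Budgeted S' → IsResidual S.Exc S.D α N → AxisOrdLE Nor L N 8) :=
  ⟨fun _ _ _ _ _ _ hL hch hS => LastCentreBudget.budgeted_chart hL hch hS,
    fun _ _ _ _ _ _ _ _ _ _ hch hN hN' hρ => LastCentreAxisOrder.rho_le_rho_of_point hch hN hN' hρ,
    LastCentreBedC.not_lastCentreConeBound_coordCanonical⟩

end Summit.ResolutionOfSingularities.ResolutionOfSingularities.Theorems.FInjectiveMacaulayfication.FCensusRegistrar3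

end
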